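import Mathlib
import Summits.ValiantsHypothesis.ValiantsHypothesis.Theorems.RigidityForcesSymmetryRankRigidMinimalReprLaplaceFiveSectorSplitDefs
import Summits.ValiantsHypothesis.ValiantsHypothesis.Theorems.RigidityForcesSymmetryRankRigidMinimalReprLaplaceFiveSymmetricPieces
import Summits.ValiantsHypothesis.ValiantsHypothesis.Theorems.RigidityForcesSymmetryRankRigidMinimalReprLaplaceFiveTriangleNoSideSym

/-!
# ValiantsHypothesis / RigidityForcesSymmetry — crux `LaplaceOptimalFive` (stmt-ValiantsHypothesis-24813), crux idea
`young-shadow` (K1) on the 4-CYCLE support `C₄ = {01, 12, 23, 03}`: **THE SUM-RIGID ENDGAME** (`stub_endgame` of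
`Cruxes/LaplaceOptimalFive/SumRigidC4Sketch.lean`, val-idea-19 g7, vocabulary unfolded)

SUM-RIGIDITY (pen note `NOTE-g7-24813-star-closed-rays.md` §12 / §12.L, refereed crit-3 g5): on `C₄` the total letter matrix of a
side-symmetric pair decomposition of `P₅` agrees with `Cat₂,₃(x₀⋯x₄)` on the two-sided-squarefree patterns — the three generic
identities (classes `11111 ↦ 1`, `2111 ↦ 0`, `221 ↦ 0`), proved in the sketch by certificates, enter here as HYPOTHESES `h1 h2 h3`.
This file proves the endgame: transport every term to the reference split `{0,1} | {2,3,4}` with the CONCRETE slot permutations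
`1`, `(01)(02)`, `(02)(13)`, `(13)(12)` (the placements of `h1`–`h3`), let `R k := Σ_t u t (ρ_k ∘ σ_{S t}) • (v ↦ w t (v ∘ σ_{S t}))` be
the ten row combinations (`ρ_k` freezes the pair `(ea k, eb k)` on the slots `0,1`); by cylindricity `R k` evaluated at the dual test
word `tv l` of ✓ `LaplaceFiveSymmetricPieces.rows_dual` is the transported total at a two-sided-squarefree word, which `h1`–`h3`
(after a slot permutation inside `{0,1} × {2,3,4}`, nine coincidence patterns) evaluate to `[k = l]`; hence the ten `R k` are
independent inside the span of the `|T|` long factors and `10 ≤ |T|`.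

Honest framing.  K1 on `C₄` follows in the sketch by composition (`sideSym_C4canon`); K1 on the star / `K₃ ⊔ K₂` / `≥ 5` splits, S2′,
`LaplaceOptimalFive` (OPEN · CONTESTED 72/120), `RankRigidMinimalRepr`, `VP ≠ VNP` are NOT proved here.  No definitions, no `sorry`.
-/

set_option linter.dupNamespace false

namespace Summit.ValiantsHypothesis.ValiantsHypothesis.Theorems.RigidityForcesSymmetryRankRigidMinimalRepr

namespace LaplaceFiveSumRigidC4

open Finset LaplaceFiveSectorSplit

variable {N : ℕ}

/-- **Sum-rigid endgame on `C₄`** (`stub_endgame` of the `SumRigidC4` sketch, shadows unfolded). [folklore] -/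
theorem endgame (T : Finset (Fin N)) (S : Fin N → Finset (Fin 5)) (u w : Fin N → (Fin 5 → Fin 5) → ℂ)
    (hdec : IsSplitDecomposition T S u w) (hsym : SideSymmetric T S u w)
    (hC : ∀ t ∈ T, S t = {0, 1} ∨ S t = {1, 2} ∨ S t = {2, 3} ∨ S t = {0, 3})
    (h1 : ∀ a b c d e : Fin 5, Function.Injective ![a, b, c, d, e] →
      (∑ t ∈ T.filter (fun t => S t = {0, 1}), u t ![a, b, c, d, e] * w t ![a, b, c, d, e])
        + (∑ t ∈ T.filter (fun t => S t = {1, 2}), u t ![c, a, b, d, e] * w t ![c, a, b, d, e])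
        + (∑ t ∈ T.filter (fun t => S t = {2, 3}), u t ![c, d, a, b, e] * w t ![c, d, a, b, e])
        + (∑ t ∈ T.filter (fun t => S t = {0, 3}), u t ![a, c, d, b, e] * w t ![a, c, d, b, e]) = 1)
    (h2 : ∀ a b c d : Fin 5, Function.Injective ![a, b, c, d] →
      (∑ t ∈ T.filter (fun t => S t = {0, 1}), u t ![a, b, a, c, d] * w t ![a, b, a, c, d])
        + (∑ t ∈ T.filter (fun t => S t = {1, 2}), u t ![a, a, b, c, d] * w t ![a, a, b, c, d])
        + (∑ t ∈ T.filter (fun t => S t = {2, 3}), u t ![a, c, a, b, d] * w t ![a, c, a, b, d])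
        + (∑ t ∈ T.filter (fun t => S t = {0, 3}), u t ![a, a, c, b, d] * w t ![a, a, c, b, d]) = 0)
    (h3 : ∀ a b c : Fin 5, Function.Injective ![a, b, c] →
      (∑ t ∈ T.filter (fun t => S t = {0, 1}), u t ![a, b, a, b, c] * w t ![a, b, a, b, c])
        + (∑ t ∈ T.filter (fun t => S t = {1, 2}), u t ![a, a, b, b, c] * w t ![a, a, b, b, c])
        + (∑ t ∈ T.filter (fun t => S t = {2, 3}), u t ![a, b, a, b, c] * w t ![a, b, a, b, c])
        + (∑ t ∈ T.filter (fun t => S t = {0, 3}), u t ![a, a, b, b, c] * w t ![a, a, b, b, c]) = 0) :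
    10 ≤ T.card := by
  classical
  obtain ⟨hu, hw, -⟩ := hdec
  -- the concrete transport permutations
  set σ : Finset (Fin 5) → Equiv.Perm (Fin 5) := fun A =>
    if A = {1, 2} then Equiv.swap 0 1 * Equiv.swap 0 2
    else if A = {2, 3} then Equiv.swap 0 2 * Equiv.swap 1 3
    else if A = {0, 3} then Equiv.swap 1 3 * Equiv.swap 1 2 else 1 with hσdef
  have σ01 : σ {0, 1} = 1 := by
    show (if ({0, 1} : Finset (Fin 5)) = {1, 2} then Equiv.swap 0 1 * Equiv.swap 0 2
      else if ({0, 1} : Finset (Fin 5)) = {2, 3} then Equiv.swap 0 2 * Equiv.swap 1 3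
      else if ({0, 1} : Finset (Fin 5)) = {0, 3} then Equiv.swap 1 3 * Equiv.swap 1 2 else 1) = 1
    rw [if_neg (by decide), if_neg (by decide), if_neg (by decide)]
  have σ12 : σ {1, 2} = Equiv.swap 0 1 * Equiv.swap 0 2 := by
    show (if ({1, 2} : Finset (Fin 5)) = {1, 2} then Equiv.swap 0 1 * Equiv.swap 0 2
      else if ({1, 2} : Finset (Fin 5)) = {2, 3} then Equiv.swap 0 2 * Equiv.swap 1 3
      else if ({1, 2} : Finset (Fin 5)) = {0, 3} then Equiv.swap 1 3 * Equiv.swap 1 2 else 1) = _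
    rw [if_pos rfl]
  have σ23 : σ {2, 3} = Equiv.swap 0 2 * Equiv.swap 1 3 := by
    show (if ({2, 3} : Finset (Fin 5)) = {1, 2} then Equiv.swap 0 1 * Equiv.swap 0 2
      else if ({2, 3} : Finset (Fin 5)) = {2, 3} then Equiv.swap 0 2 * Equiv.swap 1 3
      else if ({2, 3} : Finset (Fin 5)) = {0, 3} then Equiv.swap 1 3 * Equiv.swap 1 2 else 1) = _
    rw [if_neg (by decide), if_pos rfl]
  have σ03 : σ {0, 3} = Equiv.swap 1 3 * Equiv.swap 1 2 := by
    show (if ({0, 3} : Finset (Fin 5)) = {1, 2} then Equiv.swap 0 1 * Equiv.swap 0 2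
      else if ({0, 3} : Finset (Fin 5)) = {2, 3} then Equiv.swap 0 2 * Equiv.swap 1 3
      else if ({0, 3} : Finset (Fin 5)) = {0, 3} then Equiv.swap 1 3 * Equiv.swap 1 2 else 1) = _
    rw [if_neg (by decide), if_neg (by decide), if_pos rfl]
  have hσ : ∀ A : Finset (Fin 5), (A = {0, 1} ∨ A = {1, 2} ∨ A = {2, 3} ∨ A = {0, 3}) →
      (∀ i ∈ A, σ A i = 0 ∨ σ A i = 1) ∧ (∀ i, i ∉ A → σ A i ≠ 0 ∧ σ A i ≠ 1) := by
    rintro A (rfl | rfl | rfl | rfl)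
    · rw [σ01]; decide
    · rw [σ12]; decide
    · rw [σ23]; decide
    · rw [σ03]; decide
  -- the transported total
  set Pt : (Fin 5 → Fin 5) → ℂ := fun ω => ∑ t ∈ T, u t (ω ∘ ⇑(σ (S t))) * w t (ω ∘ ⇑(σ (S t))) with hPtdef
  have hPt : ∀ ω : Fin 5 → Fin 5, Pt ω
      = (∑ t ∈ T.filter (fun t => S t = {0, 1}), u t ω * w t ω)
        + (∑ t ∈ T.filter (fun t => S t = {1, 2}), u t ![ω 2, ω 0, ω 1, ω 3, ω 4] * w t ![ω 2, ω 0, ω 1, ω 3, ω 4])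
        + (∑ t ∈ T.filter (fun t => S t = {2, 3}), u t ![ω 2, ω 3, ω 0, ω 1, ω 4] * w t ![ω 2, ω 3, ω 0, ω 1, ω 4])
        + (∑ t ∈ T.filter (fun t => S t = {0, 3}), u t ![ω 0, ω 2, ω 3, ω 1, ω 4] * w t ![ω 0, ω 2, ω 3, ω 1, ω 4]) := by
    intro ω
    have hmaps : ∀ t ∈ T, S t ∈ ({{0, 1}, {1, 2}, {2, 3}, {0, 3}} : Finset (Finset (Fin 5))) := by
      intro t ht
      rcases hC t ht with h | h | h | h <;> simp [h]
    rw [hPtdef]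
    simp only
    rw [← Finset.sum_fiberwise_of_maps_to hmaps, Finset.sum_insert (by decide), Finset.sum_insert (by decide),
      Finset.sum_insert (by decide), Finset.sum_singleton]
    have e01 : ω ∘ ⇑(σ {0, 1}) = ω := by rw [σ01]; rfl
    have e12 : ω ∘ ⇑(σ {1, 2}) = ![ω 2, ω 0, ω 1, ω 3, ω 4] := by
      rw [σ12]; funext i; fin_cases i <;> exact congrArg ω (by decide)
    have e23 : ω ∘ ⇑(σ {2, 3}) = ![ω 2, ω 3, ω 0, ω 1, ω 4] := by
      rw [σ23]; funext i; fin_cases i <;> exact congrArg ω (by decide)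
    have e03 : ω ∘ ⇑(σ {0, 3}) = ![ω 0, ω 2, ω 3, ω 1, ω 4] := by
      rw [σ03]; funext i; fin_cases i <;> exact congrArg ω (by decide)
    have r : ∀ A : Finset (Fin 5), (∑ t ∈ T.filter (fun t => S t = A), u t (ω ∘ ⇑(σ (S t))) * w t (ω ∘ ⇑(σ (S t))))
        = ∑ t ∈ T.filter (fun t => S t = A), u t (ω ∘ ⇑(σ A)) * w t (ω ∘ ⇑(σ A)) := fun A =>
      Finset.sum_congr rfl fun t ht => by rw [(Finset.mem_filter.mp ht).2]
    rw [r, r, r, r, e01, e12, e23, e03]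
    ring
  -- the transported total is invariant under slot permutations preserving `{0,1}`
  have hside : ∀ A : Finset (Fin 5), ∀ τ : Equiv.Perm (Fin 5), ∀ v : Fin 5 → Fin 5,
      ((∀ i, i ∉ A → τ i = i) ∨ (∀ i, i ∉ Aᶜ → τ i = i)) →
      (∑ t ∈ T.filter (fun t => S t = A), u t (v ∘ ⇑τ) * w t (v ∘ ⇑τ))
        = ∑ t ∈ T.filter (fun t => S t = A), u t v * w t v := by
    intro A τ v hτ
    rcases hτ with hτ | hτ
    · exact LaplaceFiveTriangleSeparation.shadow_inv_left T S u w hw hsym A τ hτ v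
    · exact LaplaceFiveTriangleSeparation.shadow_inv_right T S u w hu hsym A τ hτ v
  have inv01 : ∀ ω : Fin 5 → Fin 5, Pt (ω ∘ ⇑(Equiv.swap 0 1)) = Pt ω := by
    intro ω
    rw [hPt, hPt]
    have a1 : (![(ω ∘ ⇑(Equiv.swap 0 1)) 2, (ω ∘ ⇑(Equiv.swap 0 1)) 0, (ω ∘ ⇑(Equiv.swap 0 1)) 1,
        (ω ∘ ⇑(Equiv.swap 0 1)) 3, (ω ∘ ⇑(Equiv.swap 0 1)) 4] : Fin 5 → Fin 5)
        = ![ω 2, ω 0, ω 1, ω 3, ω 4] ∘ ⇑(Equiv.swap 1 2) := by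
      funext i; fin_cases i <;> exact congrArg ω (by decide)
    have a2 : (![(ω ∘ ⇑(Equiv.swap 0 1)) 2, (ω ∘ ⇑(Equiv.swap 0 1)) 3, (ω ∘ ⇑(Equiv.swap 0 1)) 0,
        (ω ∘ ⇑(Equiv.swap 0 1)) 1, (ω ∘ ⇑(Equiv.swap 0 1)) 4] : Fin 5 → Fin 5)
        = ![ω 2, ω 3, ω 0, ω 1, ω 4] ∘ ⇑(Equiv.swap 2 3) := by
      funext i; fin_cases i <;> exact congrArg ω (by decide)
    have a3 : (![(ω ∘ ⇑(Equiv.swap 0 1)) 0, (ω ∘ ⇑(Equiv.swap 0 1)) 2, (ω ∘ ⇑(Equiv.swap 0 1)) 3,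
        (ω ∘ ⇑(Equiv.swap 0 1)) 1, (ω ∘ ⇑(Equiv.swap 0 1)) 4] : Fin 5 → Fin 5)
        = ![ω 0, ω 2, ω 3, ω 1, ω 4] ∘ ⇑(Equiv.swap 0 3) := by
      funext i; fin_cases i <;> exact congrArg ω (by decide)
    rw [a1, a2, a3, hside {0, 1} _ _ (Or.inl (by decide)), hside {1, 2} _ _ (Or.inl (by decide)),
      hside {2, 3} _ _ (Or.inl (by decide)), hside {0, 3} _ _ (Or.inl (by decide))]
  have inv23 : ∀ ω : Fin 5 → Fin 5, Pt (ω ∘ ⇑(Equiv.swap 2 3)) = Pt ω := by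
    intro ω
    rw [hPt, hPt]
    have a1 : (![(ω ∘ ⇑(Equiv.swap 2 3)) 2, (ω ∘ ⇑(Equiv.swap 2 3)) 0, (ω ∘ ⇑(Equiv.swap 2 3)) 1,
        (ω ∘ ⇑(Equiv.swap 2 3)) 3, (ω ∘ ⇑(Equiv.swap 2 3)) 4] : Fin 5 → Fin 5)
        = ![ω 2, ω 0, ω 1, ω 3, ω 4] ∘ ⇑(Equiv.swap 0 3) := by
      funext i; fin_cases i <;> exact congrArg ω (by decide)
    have a2 : (![(ω ∘ ⇑(Equiv.swap 2 3)) 2, (ω ∘ ⇑(Equiv.swap 2 3)) 3, (ω ∘ ⇑(Equiv.swap 2 3)) 0,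
        (ω ∘ ⇑(Equiv.swap 2 3)) 1, (ω ∘ ⇑(Equiv.swap 2 3)) 4] : Fin 5 → Fin 5)
        = ![ω 2, ω 3, ω 0, ω 1, ω 4] ∘ ⇑(Equiv.swap 0 1) := by
      funext i; fin_cases i <;> exact congrArg ω (by decide)
    have a3 : (![(ω ∘ ⇑(Equiv.swap 2 3)) 0, (ω ∘ ⇑(Equiv.swap 2 3)) 2, (ω ∘ ⇑(Equiv.swap 2 3)) 3,
        (ω ∘ ⇑(Equiv.swap 2 3)) 1, (ω ∘ ⇑(Equiv.swap 2 3)) 4] : Fin 5 → Fin 5)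
        = ![ω 0, ω 2, ω 3, ω 1, ω 4] ∘ ⇑(Equiv.swap 1 2) := by
      funext i; fin_cases i <;> exact congrArg ω (by decide)
    rw [a1, a2, a3, hside {0, 1} _ _ (Or.inr (by decide)), hside {1, 2} _ _ (Or.inr (by decide)),
      hside {2, 3} _ _ (Or.inr (by decide)), hside {0, 3} _ _ (Or.inr (by decide))]
  have inv34 : ∀ ω : Fin 5 → Fin 5, Pt (ω ∘ ⇑(Equiv.swap 3 4)) = Pt ω := by
    intro ω
    rw [hPt, hPt]
    have a1 : (![(ω ∘ ⇑(Equiv.swap 3 4)) 2, (ω ∘ ⇑(Equiv.swap 3 4)) 0, (ω ∘ ⇑(Equiv.swap 3 4)) 1,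
        (ω ∘ ⇑(Equiv.swap 3 4)) 3, (ω ∘ ⇑(Equiv.swap 3 4)) 4] : Fin 5 → Fin 5)
        = ![ω 2, ω 0, ω 1, ω 3, ω 4] ∘ ⇑(Equiv.swap 3 4) := by
      funext i; fin_cases i <;> exact congrArg ω (by decide)
    have a2 : (![(ω ∘ ⇑(Equiv.swap 3 4)) 2, (ω ∘ ⇑(Equiv.swap 3 4)) 3, (ω ∘ ⇑(Equiv.swap 3 4)) 0,
        (ω ∘ ⇑(Equiv.swap 3 4)) 1, (ω ∘ ⇑(Equiv.swap 3 4)) 4] : Fin 5 → Fin 5)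
        = ![ω 2, ω 3, ω 0, ω 1, ω 4] ∘ ⇑(Equiv.swap 1 4) := by
      funext i; fin_cases i <;> exact congrArg ω (by decide)
    have a3 : (![(ω ∘ ⇑(Equiv.swap 3 4)) 0, (ω ∘ ⇑(Equiv.swap 3 4)) 2, (ω ∘ ⇑(Equiv.swap 3 4)) 3,
        (ω ∘ ⇑(Equiv.swap 3 4)) 1, (ω ∘ ⇑(Equiv.swap 3 4)) 4] : Fin 5 → Fin 5)
        = ![ω 0, ω 2, ω 3, ω 1, ω 4] ∘ ⇑(Equiv.swap 2 4) := by
      funext i; fin_cases i <;> exact congrArg ω (by decide)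
    rw [a1, a2, a3, hside {0, 1} _ _ (Or.inr (by decide)), hside {1, 2} _ _ (Or.inr (by decide)),
      hside {2, 3} _ _ (Or.inr (by decide)), hside {0, 3} _ _ (Or.inr (by decide))]
  -- the ten evaluation patterns of the transported total on two-sided-squarefree words
  have L1 : ∀ a b c d e : Fin 5, Function.Injective ![a, b, c, d, e] → Pt ![a, b, c, d, e] = 1 := by
    intro a b c d e h; rw [hPt]; exact h1 a b c d e h
  have Za2 : ∀ a b c d : Fin 5, Function.Injective ![a, b, c, d] → Pt ![a, b, a, c, d] = 0 := by
    intro a b c d h; rw [hPt]; exact h2 a b c d h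
  have Zab23 : ∀ a b c : Fin 5, Function.Injective ![a, b, c] → Pt ![a, b, a, b, c] = 0 := by
    intro a b c h; rw [hPt]; exact h3 a b c h
  have Za3 : ∀ a b c d : Fin 5, Function.Injective ![a, b, c, d] → Pt ![a, b, c, a, d] = 0 := by
    intro a b c d h
    have e : (![a, b, c, a, d] : Fin 5 → Fin 5) = ![a, b, a, c, d] ∘ ⇑(Equiv.swap 2 3) := by
      funext i; fin_cases i <;> rfl
    rw [e, inv23]; exact Za2 a b c d h
  have Za4 : ∀ a b c d : Fin 5, Function.Injective ![a, b, c, d] → Pt ![a, b, c, d, a] = 0 := by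
    intro a b c d h
    have e : (![a, b, c, d, a] : Fin 5 → Fin 5) = ![a, b, c, a, d] ∘ ⇑(Equiv.swap 3 4) := by
      funext i; fin_cases i <;> rfl
    rw [e, inv34]; exact Za3 a b c d h
  have Zb2 : ∀ a b c d : Fin 5, Function.Injective ![b, a, c, d] → Pt ![a, b, b, c, d] = 0 := by
    intro a b c d h
    have e : (![a, b, b, c, d] : Fin 5 → Fin 5) = ![b, a, b, c, d] ∘ ⇑(Equiv.swap 0 1) := by
      funext i; fin_cases i <;> rfl
    rw [e, inv01]; exact Za2 b a c d h
  have Zb3 : ∀ a b c d : Fin 5, Function.Injective ![b, a, c, d] → Pt ![a, b, c, b, d] = 0 := by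
    intro a b c d h
    have e : (![a, b, c, b, d] : Fin 5 → Fin 5) = ![a, b, b, c, d] ∘ ⇑(Equiv.swap 2 3) := by
      funext i; fin_cases i <;> rfl
    rw [e, inv23]; exact Zb2 a b c d h
  have Zb4 : ∀ a b c d : Fin 5, Function.Injective ![b, a, c, d] → Pt ![a, b, c, d, b] = 0 := by
    intro a b c d h
    have e : (![a, b, c, d, b] : Fin 5 → Fin 5) = ![a, b, c, b, d] ∘ ⇑(Equiv.swap 3 4) := by
      funext i; fin_cases i <;> rfl
    rw [e, inv34]; exact Zb3 a b c d h
  have Zab24 : ∀ a b c : Fin 5, Function.Injective ![a, b, c] → Pt ![a, b, a, c, b] = 0 := by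
    intro a b c h
    have e : (![a, b, a, c, b] : Fin 5 → Fin 5) = ![a, b, a, b, c] ∘ ⇑(Equiv.swap 3 4) := by
      funext i; fin_cases i <;> rfl
    rw [e, inv34]; exact Zab23 a b c h
  have Zab34 : ∀ a b c : Fin 5, Function.Injective ![a, b, c] → Pt ![a, b, c, a, b] = 0 := by
    intro a b c h
    have e : (![a, b, c, a, b] : Fin 5 → Fin 5) = ![a, b, a, c, b] ∘ ⇑(Equiv.swap 2 3) := by
      funext i; fin_cases i <;> rfl
    rw [e, inv23]; exact Zab24 a b c h
  -- rows, test words, long-side functions (as in `symmetricPieces_needTen`)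
  set G : Fin N → ((Fin 5 → Fin 5) → ℂ) := fun t v => w t (v ∘ ⇑(σ (S t))) with hG
  set ea : Fin 10 → Fin 5 := ![0, 0, 0, 0, 1, 1, 1, 2, 2, 3] with hea
  set eb : Fin 10 → Fin 5 := ![1, 2, 3, 4, 2, 3, 4, 3, 4, 4] with heb
  set tv : Fin 10 → Fin 5 → Fin 5 := ![![0, 1, 2, 3, 4], ![0, 2, 1, 3, 4], ![0, 3, 1, 2, 4], ![0, 4, 1, 2, 3],
    ![1, 2, 0, 3, 4], ![1, 3, 0, 2, 4], ![1, 4, 0, 2, 3], ![2, 3, 0, 1, 4], ![2, 4, 0, 1, 3], ![3, 4, 0, 1, 2]] with htv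
  set ρ : Fin 10 → Fin 5 → Fin 5 := fun k i => if i = 0 then ea k else if i = 1 then eb k else 0 with hρ
  set R : Fin 10 → ((Fin 5 → Fin 5) → ℂ) := fun k => ∑ t ∈ T, (u t (ρ k ∘ ⇑(σ (S t)))) • G t with hR
  -- evaluation of a row at a test word = the transported total at the frozen word
  have hRP : ∀ k l : Fin 10, R k (tv l) = Pt ![ea k, eb k, tv l 2, tv l 3, tv l 4] := by
    intro k l
    simp only [hR, hPtdef, hG, Finset.sum_apply, Pi.smul_apply, smul_eq_mul]
    refine Finset.sum_congr rfl fun t ht => ?_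
    obtain ⟨hin, hout⟩ := hσ (S t) (hC t ht)
    congr 1
    · refine hu t _ _ fun i hi => ?_
      simp only [Function.comp]
      rcases hin i hi with h0 | h1'
      · rw [h0]; simp [hρ]
      · rw [h1']; simp [hρ]
    · refine hw t _ _ fun i hi => ?_
      simp only [Function.comp]
      obtain ⟨h0, h1'⟩ := hout i hi
      have key : ∀ j : Fin 5, j ≠ 0 → j ≠ 1 → tv l j = (![ea k, eb k, tv l 2, tv l 3, tv l 4] : Fin 5 → Fin 5) j := by
        intro j hj0 hj1
        fin_cases j
        · exact absurd rfl hj0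
        · exact absurd rfl hj1
        · rfl
        · rfl
        · rfl
      exact key _ h0 h1'
  -- three more placements (repeated letter of the second pair slot before that of the first)
  have Zba23 : ∀ a b c : Fin 5, Function.Injective ![a, b, c] → Pt ![a, b, b, a, c] = 0 := by
    intro a b c h
    have e : (![a, b, b, a, c] : Fin 5 → Fin 5) = ![a, b, a, b, c] ∘ ⇑(Equiv.swap 2 3) := by
      funext i; fin_cases i <;> rfl
    rw [e, inv23]; exact Zab23 a b c h
  have Zba24 : ∀ a b c : Fin 5, Function.Injective ![a, b, c] → Pt ![a, b, b, c, a] = 0 := by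
    intro a b c h
    have e : (![a, b, b, c, a] : Fin 5 → Fin 5) = ![a, b, b, a, c] ∘ ⇑(Equiv.swap 3 4) := by
      funext i; fin_cases i <;> rfl
    rw [e, inv34]; exact Zba23 a b c h
  have Zba34 : ∀ a b c : Fin 5, Function.Injective ![a, b, c] → Pt ![a, b, c, b, a] = 0 := by
    intro a b c h
    have e : (![a, b, c, b, a] : Fin 5 → Fin 5) = ![a, b, c, a, b] ∘ ⇑(Equiv.swap 3 4) := by
      funext i; fin_cases i <;> rfl
    rw [e, inv34]; exact Zab34 a b c h
  -- injectivity of short vectors from pairwise distinctness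
  have inj3 : ∀ a b c : Fin 5, a ≠ b → a ≠ c → b ≠ c → Function.Injective ![a, b, c] := by
    intro a b c hab hac hbc i j h
    fin_cases i <;> fin_cases j <;> simp at h <;> first | rfl | exact absurd h ‹_› | exact absurd h.symm ‹_›
  have inj4 : ∀ a b c d : Fin 5, a ≠ b → a ≠ c → a ≠ d → b ≠ c → b ≠ d → c ≠ d →
      Function.Injective ![a, b, c, d] := by
    intro a b c d hab hac had hbc hbd hcd i j h
    fin_cases i <;> fin_cases j <;> simp at h <;> first | rfl | exact absurd h ‹_› | exact absurd h.symm ‹_›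
  have inj5 : ∀ a b c d e : Fin 5, a ≠ b → a ≠ c → a ≠ d → a ≠ e → b ≠ c → b ≠ d → b ≠ e → c ≠ d → c ≠ e → d ≠ e →
      Function.Injective ![a, b, c, d, e] := by
    intro a b c d e hab hac had hae hbc hbd hbe hcd hce hde i j h
    fin_cases i <;> fin_cases j <;> simp at h <;> first | rfl | exact absurd h ‹_› | exact absurd h.symm ‹_›
  -- the transported total on every two-sided-squarefree word (thirteen coincidence patterns)
  have GenEval : ∀ ω : Fin 5 → Fin 5, ω 0 ≠ ω 1 → ω 2 ≠ ω 3 → ω 2 ≠ ω 4 → ω 3 ≠ ω 4 →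
      Pt ω = if Function.Injective ω then 1 else 0 := by
    intro ω h01 h23 h24 h34
    have hω : ω = ![ω 0, ω 1, ω 2, ω 3, ω 4] := by funext i; fin_cases i <;> rfl
    have hP : Pt ω = Pt ![ω 0, ω 1, ω 2, ω 3, ω 4] := congrArg Pt hω
    have ninj : ∀ i j : Fin 5, i ≠ j → ω i = ω j → ¬ Function.Injective ω := fun i j hij h hinj => hij (hinj h)
    by_cases h20 : ω 2 = ω 0
    · rw [if_neg (ninj 2 0 (by decide) h20), hP, h20]
      have h30 : ω 3 ≠ ω 0 := fun h => h23 (h20.trans h.symm)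
      have h40 : ω 4 ≠ ω 0 := fun h => h24 (h20.trans h.symm)
      by_cases h31 : ω 3 = ω 1
      · rw [h31]
        have h41 : ω 4 ≠ ω 1 := fun h => h34 (h31.trans h.symm)
        exact Zab23 _ _ _ (inj3 _ _ _ h01 h40.symm h41.symm)
      · by_cases h41 : ω 4 = ω 1
        · rw [h41]
          exact Zab24 _ _ _ (inj3 _ _ _ h01 h30.symm (Ne.symm h31))
        · exact Za2 _ _ _ _ (inj4 _ _ _ _ h01 h30.symm h40.symm (Ne.symm h31) (Ne.symm h41) h34)
    · by_cases h21 : ω 2 = ω 1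
      · rw [if_neg (ninj 2 1 (by decide) h21), hP, h21]
        have h31 : ω 3 ≠ ω 1 := fun h => h23 (h21.trans h.symm)
        have h41 : ω 4 ≠ ω 1 := fun h => h24 (h21.trans h.symm)
        by_cases h30 : ω 3 = ω 0
        · rw [h30]
          have h40 : ω 4 ≠ ω 0 := fun h => h34 (h30.trans h.symm)
          exact Zba23 _ _ _ (inj3 _ _ _ h01 h40.symm h41.symm)
        · by_cases h40 : ω 4 = ω 0
          · rw [h40]
            exact Zba24 _ _ _ (inj3 _ _ _ h01 (Ne.symm h30) h31.symm)
          · exact Zb2 _ _ _ _ (inj4 _ _ _ _ (Ne.symm h01) h31.symm h41.symm (Ne.symm h30) (Ne.symm h40) h34)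
      · by_cases h30 : ω 3 = ω 0
        · rw [if_neg (ninj 3 0 (by decide) h30), hP, h30]
          have h40 : ω 4 ≠ ω 0 := fun h => h34 (h30.trans h.symm)
          by_cases h41 : ω 4 = ω 1
          · rw [h41]
            exact Zab34 _ _ _ (inj3 _ _ _ h01 (Ne.symm h20) (Ne.symm h21))
          · exact Za3 _ _ _ _ (inj4 _ _ _ _ h01 (Ne.symm h20) h40.symm (Ne.symm h21) (Ne.symm h41) h24)
        · by_cases h31 : ω 3 = ω 1
          · rw [if_neg (ninj 3 1 (by decide) h31), hP, h31]
            have h41 : ω 4 ≠ ω 1 := fun h => h34 (h31.trans h.symm)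
            by_cases h40 : ω 4 = ω 0
            · rw [h40]
              exact Zba34 _ _ _ (inj3 _ _ _ h01 (Ne.symm h20) (Ne.symm h21))
            · exact Zb3 _ _ _ _ (inj4 _ _ _ _ (Ne.symm h01) (Ne.symm h21) h41.symm (Ne.symm h20) (Ne.symm h40) h24)
          · by_cases h40 : ω 4 = ω 0
            · rw [if_neg (ninj 4 0 (by decide) h40), hP, h40]
              exact Za4 _ _ _ _ (inj4 _ _ _ _ h01 (Ne.symm h20) (Ne.symm h30) (Ne.symm h21) (Ne.symm h31) h23)
            · by_cases h41 : ω 4 = ω 1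
              · rw [if_neg (ninj 4 1 (by decide) h41), hP, h41]
                exact Zb4 _ _ _ _ (inj4 _ _ _ _ (Ne.symm h01) (Ne.symm h21) (Ne.symm h31) (Ne.symm h20) (Ne.symm h30) h23)
              · have hinj : Function.Injective ![ω 0, ω 1, ω 2, ω 3, ω 4] :=
                  inj5 _ _ _ _ _ h01 (Ne.symm h20) (Ne.symm h30) (Ne.symm h40) (Ne.symm h21) (Ne.symm h31)
                    (Ne.symm h41) h23 h24 h34
                have hinj' : Function.Injective ω := by rw [hω]; exact hinj
                rw [if_pos hinj', hP]
                exact L1 _ _ _ _ _ hinj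
  -- side conditions and duality on the concrete tables
  have sc : ∀ k l : Fin 10,
      (![ea k, eb k, tv l 2, tv l 3, tv l 4] : Fin 5 → Fin 5) 0 ≠ (![ea k, eb k, tv l 2, tv l 3, tv l 4] : Fin 5 → Fin 5) 1
      ∧ (![ea k, eb k, tv l 2, tv l 3, tv l 4] : Fin 5 → Fin 5) 2 ≠ (![ea k, eb k, tv l 2, tv l 3, tv l 4] : Fin 5 → Fin 5) 3
      ∧ (![ea k, eb k, tv l 2, tv l 3, tv l 4] : Fin 5 → Fin 5) 2 ≠ (![ea k, eb k, tv l 2, tv l 3, tv l 4] : Fin 5 → Fin 5) 4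
      ∧ (![ea k, eb k, tv l 2, tv l 3, tv l 4] : Fin 5 → Fin 5) 3 ≠ (![ea k, eb k, tv l 2, tv l 3, tv l 4] : Fin 5 → Fin 5) 4 := by
    simp only [hea, heb, htv]
    decide
  have hrows : ∀ k l : Fin 10,
      Function.Injective (![ea k, eb k, tv l 2, tv l 3, tv l 4] : Fin 5 → Fin 5) ↔ k = l := by
    simp only [hea, heb, htv]
    decide
  have hdual : ∀ k l : Fin 10, R k (tv l) = if k = l then 1 else 0 := by
    intro k l
    obtain ⟨s1, s2, s3, s4⟩ := sc k l
    rw [hRP, GenEval _ s1 s2 s3 s4, if_congr (hrows k l) rfl rfl]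
  -- the rows are linearly independent
  have hli : LinearIndependent ℂ R := by
    rw [Fintype.linearIndependent_iff]
    intro g hg k
    have := congrFun hg (tv k)
    simp only [Finset.sum_apply, Pi.smul_apply, smul_eq_mul, Pi.zero_apply, hdual] at this
    simpa using this
  -- every row lies in the span of the long-side functions (by construction)
  have hrow : ∀ k : Fin 10, R k ∈ Submodule.span ℂ ((T.image G : Finset ((Fin 5 → Fin 5) → ℂ)) : Set ((Fin 5 → Fin 5) → ℂ)) := by
    intro k
    refine Submodule.sum_mem _ fun t ht => Submodule.smul_mem _ _ (Submodule.subset_span ?_)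
    exact Finset.mem_coe.mpr (Finset.mem_image_of_mem G ht)
  -- count dimensions
  have d1 : Module.finrank ℂ (Submodule.span ℂ (Set.range R)) = 10 := by
    rw [finrank_span_eq_card hli, Fintype.card_fin]
  have d2 : Submodule.span ℂ (Set.range R)
      ≤ Submodule.span ℂ ((T.image G : Finset ((Fin 5 → Fin 5) → ℂ)) : Set ((Fin 5 → Fin 5) → ℂ)) := by
    rw [Submodule.span_le]
    rintro _ ⟨k, rfl⟩
    exact hrow k
  have d3 := Submodule.finrank_mono d2
  have d4 : Module.finrank ℂ (Submodule.span ℂ ((T.image G : Finset ((Fin 5 → Fin 5) → ℂ)) : Set ((Fin 5 → Fin 5) → ℂ)))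
      ≤ (T.image G).card :=
    finrank_span_finset_le_card (R := ℂ) (M := (Fin 5 → Fin 5) → ℂ) (T.image G)
  have d5 : (T.image G).card ≤ T.card := Finset.card_image_le
  rw [d1] at d3
  omega

end LaplaceFiveSumRigidC4

end Summit.ValiantsHypothesis.ValiantsHypothesis.Theorems.RigidityForcesSymmetryRankRigidMinimalRepr
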